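import Mathlib
import Summits.NavierStokesRegularity.NavierStokesRegularity.Theorems.FilamentSkeletonRssStadiumOwnFarAbs
import Summits.NavierStokesRegularity.NavierStokesRegularity.Theorems.FilamentSkeletonRssStadiumPartnerPiece

/-!
# The OWN-filament FAR piece of the retyped contour is holomorphic and `O(1/h)` (`TangentSkeletonNearStraightL`, stmt-NavierStokesRegularity-23320,
# registered stub `stub_stripPropagation` — blueprint item R3 of `DIAG-addendum-contour-g2.md`)

Thinner stadium `S' = {|Im z| < hs', |Re z − c| < L + hs'}` with `9hs' ≤ hs` (`hs' = cs√Γ/16` in the retype), far source set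
`T = {σ : L + 8hs' ≤ |σ − c|}` (the real axis beyond the two fixed connectors).  For `z ∈ S'`, `σ ∈ T`: `|σ − Re z| > 7hs' > 7|Im z|`, chord
`d ≥ (7/8)·7hs' > 6hs' > 3|Im z|`, and the 8-fold discs fit at the target foot, so Theorems.StadiumOwnFarAbs gives the principal branch and
`‖kernel‖ ≤ (d²/3)^{−3/2}·2(d+2|y|) ≤ 18/d²` (`kernel_le_eighteen_div_sq`).  As in Theorems.StadiumPartnerPiece: a `z`-uniform Lorentzian majorant on
`|z − z₀| < hs'` (`ownFar_majorant`), holomorphy on `S'` (`ownFarPiece_differentiableOn`, Theorems.StadiumFarPieceHolomorphic) and the bound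
`‖∫_T kernel‖ ≤ 5·26·π/((7/8)·6hs')` (`ownFarPiece_norm_le`).  Real agreement: Theorems.StadiumOwnReal.own_real_setIntegral_eq on `T`.
HONEST FRAMING: a tool for a HYPOTHETICAL filament skeleton on the NEGATIVE side of a MODEL route; nothing here bears on Navier–Stokes regularity or
blow-up.  `--supports stmt-NavierStokesRegularity-23320`.
-/

set_option linter.dupNamespace false

noncomputable section

namespace Summit.NavierStokesRegularity.NavierStokesRegularity.Theorems.StadiumOwnFarPiece

open Set Metric MeasureTheory
open scoped InnerProductSpace Matrix
open Summit.NavierStokesRegularity.NavierStokesRegularity.Theorems.StadiumFarMajorant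
open Summit.NavierStokesRegularity.NavierStokesRegularity.Theorems.StadiumFarPieceHolomorphic
open Summit.NavierStokesRegularity.NavierStokesRegularity.Theorems.NearStraightEscape
open Summit.NavierStokesRegularity.NavierStokesRegularity.Theorems.StadiumOwnFarAbs
open Summit.NavierStokesRegularity.NavierStokesRegularity.Theorems.StadiumPartnerPiece

/-- `(d²/3)^{−3/2}·2(d + 2w) ≤ 18/d²` for `0 ≤ 3w ≤ d`, `0 < d`. [folklore] -/
theorem kernel_le_eighteen_div_sq {d w : ℝ} (hd : 0 < d) (hw0 : 0 ≤ w) (hw : 3 * w ≤ d) :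
    (d ^ 2 / 3) ^ (-(3/2 : ℝ)) * (2 * (d + 2 * w)) ≤ 18 / d ^ 2 := by
  have hx : 0 < d ^ 2 / 3 := by positivity
  have h1 : (d ^ 2 / 3) ^ (-(3/2 : ℝ)) = ((d ^ 2 / 3) * Real.sqrt (d ^ 2 / 3))⁻¹ := by
    rw [Real.rpow_neg hx.le, show (3/2 : ℝ) = 1 + 1/2 by norm_num, Real.rpow_add hx, Real.rpow_one, Real.sqrt_eq_rpow]
  have hsqrt : 4 / 7 * d ≤ Real.sqrt (d ^ 2 / 3) := by
    rw [show 4 / 7 * d = Real.sqrt ((4 / 7 * d) ^ 2) by rw [Real.sqrt_sq (by positivity)]]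
    exact Real.sqrt_le_sqrt (by nlinarith)
  rw [h1]
  have hprod : d ^ 2 / 3 * (4 / 7 * d) ≤ d ^ 2 / 3 * Real.sqrt (d ^ 2 / 3) := mul_le_mul_of_nonneg_left hsqrt hx.le
  have hpos : 0 < d ^ 2 / 3 * (4 / 7 * d) := by positivity
  calc ((d ^ 2 / 3) * Real.sqrt (d ^ 2 / 3))⁻¹ * (2 * (d + 2 * w))
      ≤ (d ^ 2 / 3 * (4 / 7 * d))⁻¹ * (2 * (d + 2 * w)) :=
        mul_le_mul_of_nonneg_right (inv_anti₀ hpos hprod) (by positivity)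
    _ ≤ 18 / d ^ 2 := by
        rw [inv_mul_le_iff₀ hpos]
        have e : d ^ 2 / 3 * (4 / 7 * d) * (18 / d ^ 2) = 24 / 7 * d := by field_simp; ring
        rw [e]
        nlinarith

/-- **Pointwise on the far set**: principal branch and `‖kernel‖ ≤ 18/d²`. [folklore] -/
theorem ownFar_pointwise {hs hs' L cc κ : ℝ} {F : ℂ → (Fin 3 → ℂ)}
    (hF : DifferentiableOn ℂ F {z : ℂ | |z.im| < hs ∧ |z.re - cc| < L + hs})
    (hM : ∀ z ∈ {z : ℂ | |z.im| < hs ∧ |z.re - cc| < L + hs}, ‖deriv F z‖ ≤ 2)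
    {X : ℝ → EuclideanSpace ℝ (Fin 3)} (hX : Differentiable ℝ X) (hXu : ∀ τ, ‖deriv X τ‖ = 1)
    (hosc : ∀ τ σ, ‖deriv X τ - deriv X σ‖ ≤ 1 / 2)
    (hFX : ∀ r : ℝ, (r : ℂ) ∈ {z : ℂ | |z.im| < hs ∧ |z.re - cc| < L + hs} →
      F r = fun i => ((⟪X r, EuclideanSpace.single i (1:ℝ)⟫_ℝ : ℝ) : ℂ))
    {A : ℝ → ℝ} (hA : ∀ σ, 0 ≤ A σ) (hκ : 0 ≤ κ) (hhs' : 0 < hs') (h9 : 9 * hs' ≤ hs)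
    {z : ℂ} (hz : z ∈ {z : ℂ | |z.im| < hs' ∧ |z.re - cc| < L + hs'}) {σ : ℝ} (hσ : L + 8 * hs' ≤ |σ - cc|) :
    6 * hs' ≤ ‖X z.re - X σ‖ ∧
    0 < ((∑ i, (F z i - ((X σ i : ℝ) : ℂ)) ^ 2) + ((κ * A σ : ℝ) : ℂ)).re ∧
    ‖(((∑ i, (F z i - ((X σ i : ℝ) : ℂ)) ^ 2) + ((κ * A σ : ℝ) : ℂ)) ^ ((3:ℂ) / 2))⁻¹ •
      ((fun i => ((deriv X σ i : ℝ) : ℂ)) ⨯₃ (fun i => F z i - ((X σ i : ℝ) : ℂ)))‖ ≤ 18 / ‖X z.re - X σ‖ ^ 2 := by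
  have hzim : |z.im| < hs' := hz.1
  have hzre : |z.re - cc| < L + hs' := hz.2
  -- chord
  have hxσ : 7 * hs' < |z.re - σ| := by
    have e1 : |σ - z.re| = |z.re - σ| := abs_sub_comm σ z.re
    have h1 : |σ - cc| ≤ |z.re - σ| + |z.re - cc| := by
      have := abs_add_le (σ - z.re) (z.re - cc); have e : σ - z.re + (z.re - cc) = σ - cc := by ring
      rw [e, e1] at this; exact this
    linarith
  have hchord : 7 / 8 * |z.re - σ| ≤ ‖X z.re - X σ‖ := chord_ge_seven_eighths hX hXu hosc le_rfl σ z.re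
  have hd6 : 6 * hs' ≤ ‖X z.re - X σ‖ := by nlinarith [hchord, hxσ]
  have hdpos : 0 < ‖X z.re - X σ‖ := by linarith
  have hfar : 3 * |z.im| ≤ ‖X z.re - X σ‖ := by linarith [abs_nonneg z.im]
  have hfit : 8 * |z.im| < hs := by linarith
  have hfit' : |z.re - cc| + 8 * |z.im| < L + hs := by linarith
  have hκA : 0 ≤ κ * A σ := mul_nonneg hκ (hA σ)
  have hzeq : ((z.re : ℝ) : ℂ) + ((z.im : ℝ) : ℂ) * Complex.I = z := Complex.re_add_im z
  have h := own_far_pointwise_abs hF hM hX hXu hFX hκA hfit hfit' σ hdpos hfar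
  rw [hzeq] at h
  refine ⟨hd6, lt_of_lt_of_le (by positivity) h.1, h.2.trans ?_⟩
  exact kernel_le_eighteen_div_sq hdpos (abs_nonneg _) hfar

/-- **Local uniform Lorentzian majorant** on `T` for `|z − z₀| < hs'`. [folklore] -/
theorem ownFar_majorant {hs hs' L cc κ : ℝ} {F : ℂ → (Fin 3 → ℂ)}
    (hF : DifferentiableOn ℂ F {z : ℂ | |z.im| < hs ∧ |z.re - cc| < L + hs})
    (hM : ∀ z ∈ {z : ℂ | |z.im| < hs ∧ |z.re - cc| < L + hs}, ‖deriv F z‖ ≤ 2)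
    {X : ℝ → EuclideanSpace ℝ (Fin 3)} (hX : Differentiable ℝ X) (hXu : ∀ τ, ‖deriv X τ‖ = 1)
    (hosc : ∀ τ σ, ‖deriv X τ - deriv X σ‖ ≤ 1 / 2)
    (hFX : ∀ r : ℝ, (r : ℂ) ∈ {z : ℂ | |z.im| < hs ∧ |z.re - cc| < L + hs} →
      F r = fun i => ((⟪X r, EuclideanSpace.single i (1:ℝ)⟫_ℝ : ℝ) : ℂ))
    {A : ℝ → ℝ} (hA : ∀ σ, 0 ≤ A σ) (hκ : 0 ≤ κ) (hhs' : 0 < hs') (h9 : 9 * hs' ≤ hs) (z₀ : ℂ) :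
    ∀ z ∈ {z : ℂ | |z.im| < hs' ∧ |z.re - cc| < L + hs'}, ‖z - z₀‖ < hs' → ∀ σ : ℝ, L + 8 * hs' ≤ |σ - cc| →
      ‖(((∑ i, (F z i - ((X σ i : ℝ) : ℂ)) ^ 2) + ((κ * A σ : ℝ) : ℂ)) ^ ((3:ℂ) / 2))⁻¹ •
        ((fun i => ((deriv X σ i : ℝ) : ℂ)) ⨯₃ (fun i => F z i - ((X σ i : ℝ) : ℂ)))‖ ≤
        5 * 72 * ((7 / 16) ^ 2 * (σ - z₀.re) ^ 2 + (3 * hs') ^ 2)⁻¹ := by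
  intro z hz hzz₀ σ hσ
  obtain ⟨hd6, -, hker⟩ := ownFar_pointwise hF hM hX hXu hosc hFX hA hκ hhs' h9 hz hσ
  set d : ℝ := ‖X z.re - X σ‖ with hd
  -- distance from the foot of `z₀`
  set D : ℝ := ‖X z₀.re - X σ‖ with hD
  have hre : |z.re - z₀.re| < hs' := by
    have h := Complex.abs_re_le_norm (z - z₀)
    rw [Complex.sub_re] at h
    exact lt_of_le_of_lt h hzz₀
  have hXlip : ‖X z.re - X z₀.re‖ ≤ |z.re - z₀.re| := norm_sub_le_of_unit_speed hX hXu _ _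
  have hDd : D ≤ d + hs' := by
    have := norm_sub_le_norm_sub_add_norm_sub (X z₀.re) (X z.re) (X σ)
    rw [norm_sub_rev (X z₀.re) (X z.re)] at this
    linarith
  have hdpos : 0 < d := by linarith
  -- `18/d² ≤ 72/D'²` where `D' := max-free`: use `d ≥ D/2` when `D ≥ 2hs'`, and `d ≥ 6hs'` always
  -- Lorentzian: with `a = 3hs'`, `k = 7/16`, centre `z₀.re`: need `a ≤ d'` and `k|σ − z₀.re| − a ≤ d'` for `d' := d/… `; we bound directly:
  have hchord0 : 7 / 8 * |σ - z₀.re| ≤ D := by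
    have h := chord_ge_seven_eighths hX hXu hosc le_rfl σ z₀.re
    rw [abs_sub_comm] at h; exact h
  -- `d ≥ max(6hs', D − hs')` ⇒ `d ≥ (7/16)|σ − z₀.re| − 3hs'·0 …`; we use `2d ≥ D` and `d ≥ 6hs'`
  have h2d : D ≤ 2 * d := by linarith
  have hstep : 18 / d ^ 2 ≤ 72 / D ^ 2 := by
    have hDpos : 0 < D := by
      -- `D ≥ (7/8)|σ − z₀.re|` and `|σ − z₀.re| ≥ |σ − cc| − |z₀.re − cc|`; simpler: `D ≥ d − hs' ≥ 5hs' > 0`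
      have : d - hs' ≤ D := by
        have := norm_sub_le_norm_sub_add_norm_sub (X z.re) (X z₀.re) (X σ)
        linarith
      linarith
    rw [div_le_div_iff₀ (by positivity) (by positivity)]
    nlinarith [h2d, hDpos, hdpos]
  have hDge : 3 * hs' ≤ D := by
    have : d - hs' ≤ D := by
      have := norm_sub_le_norm_sub_add_norm_sub (X z.re) (X z₀.re) (X σ)
      linarith
    linarith
  have h2 : 7 / 16 * |σ - z₀.re| - 3 * hs' ≤ D := by
    have : 0 ≤ |σ - z₀.re| := abs_nonneg _
    linarith
  have hmaj := far_majorant_le (C := 72) (σ₀ := z₀.re) (σ := σ) (by positivity : (0:ℝ) < 3 * hs')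
    (by norm_num : (0:ℝ) ≤ 7 / 16) (by norm_num) hDge h2
  exact hker.trans (hstep.trans hmaj)

/-- **The own far piece is holomorphic on the thinner stadium.** [folklore] -/
theorem ownFarPiece_differentiableOn {hs hs' L cc κ : ℝ} {F : ℂ → (Fin 3 → ℂ)}
    (hF : DifferentiableOn ℂ F {z : ℂ | |z.im| < hs ∧ |z.re - cc| < L + hs})
    (hM : ∀ z ∈ {z : ℂ | |z.im| < hs ∧ |z.re - cc| < L + hs}, ‖deriv F z‖ ≤ 2)
    {X : ℝ → EuclideanSpace ℝ (Fin 3)} (hX : ContDiff ℝ 1 X) (hXu : ∀ τ, ‖deriv X τ‖ = 1)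
    (hosc : ∀ τ σ, ‖deriv X τ - deriv X σ‖ ≤ 1 / 2)
    (hFX : ∀ r : ℝ, (r : ℂ) ∈ {z : ℂ | |z.im| < hs ∧ |z.re - cc| < L + hs} →
      F r = fun i => ((⟪X r, EuclideanSpace.single i (1:ℝ)⟫_ℝ : ℝ) : ℂ))
    {A : ℝ → ℝ} (hAc : Continuous A) (hA : ∀ σ, 0 ≤ A σ) (hκ : 0 ≤ κ) (hhs' : 0 < hs') (h9 : 9 * hs' ≤ hs) :
    DifferentiableOn ℂ (fun z => ∫ σ in {σ : ℝ | L + 8 * hs' ≤ |σ - cc|},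
      (((∑ i, (F z i - ((X σ i : ℝ) : ℂ)) ^ 2) + ((κ * A σ : ℝ) : ℂ)) ^ ((3:ℂ) / 2))⁻¹ •
        ((fun i => ((deriv X σ i : ℝ) : ℂ)) ⨯₃ (fun i => F z i - ((X σ i : ℝ) : ℂ))))
      {z : ℂ | |z.im| < hs' ∧ |z.re - cc| < L + hs'} := by
  set S' : Set ℂ := {z : ℂ | |z.im| < hs' ∧ |z.re - cc| < L + hs'} with hS'
  set T : Set ℝ := {σ : ℝ | L + 8 * hs' ≤ |σ - cc|} with hT
  have hS'o : IsOpen S' := isOpen_stadium hs' (L + hs') cc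
  have hTm : MeasurableSet T := by
    have : IsClosed T := isClosed_le continuous_const (continuous_abs.comp (continuous_id.sub continuous_const))
    exact this.measurableSet
  have hXd : Differentiable ℝ X := hX.differentiable (by simp)
  intro z₀ hz₀
  have hmaj := ownFar_majorant hF hM hXd hXu hosc hFX hA hκ hhs' h9 z₀
  set V : Set ℂ := Metric.ball z₀ hs' ∩ S' with hV
  have hVo : IsOpen V := Metric.isOpen_ball.inter hS'o
  have hz₀V : z₀ ∈ V := ⟨Metric.mem_ball_self hhs', hz₀⟩
  have hVS : V ⊆ {z : ℂ | |z.im| < hs ∧ |z.re - cc| < L + hs} := fun z hz => ⟨by linarith [hz.2.1], by linarith [hz.2.2]⟩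
  have hpos : ∀ z ∈ V, ∀ σ ∈ T, 0 < ((∑ i, (F z i - ((X σ i : ℝ) : ℂ)) ^ 2) + ((κ * A σ : ℝ) : ℂ)).re :=
    fun z hz σ hσ => (ownFar_pointwise hF hM hXd hXu hosc hFX hA hκ hhs' h9 hz.2 hσ).2.1
  have ha0 : (0:ℝ) < 3 * hs' := by positivity
  have hbound : IntegrableOn (fun σ : ℝ => 5 * 72 * ((7 / 16) ^ 2 * (σ - z₀.re) ^ 2 + (3 * hs') ^ 2)⁻¹) T :=
    ((integrable_lorentzian ha0 (by norm_num : (7 / 16 : ℝ) ≠ 0) z₀.re).const_mul _).integrableOn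
  have hdom : ∀ z ∈ V, ∀ σ ∈ T,
      ‖(((∑ i, (F z i - ((X σ i : ℝ) : ℂ)) ^ 2) + ((κ * A σ : ℝ) : ℂ)) ^ ((3:ℂ) / 2))⁻¹ •
        ((fun i => ((deriv X σ i : ℝ) : ℂ)) ⨯₃ (fun i => F z i - ((X σ i : ℝ) : ℂ)))‖ ≤
        5 * 72 * ((7 / 16) ^ 2 * (σ - z₀.re) ^ 2 + (3 * hs') ^ 2)⁻¹ := by
    intro z hz σ hσ
    have hzz : ‖z - z₀‖ < hs' := by have := hz.1; rwa [Metric.mem_ball, dist_eq_norm] at this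
    exact hmaj z hz.2 hzz σ hσ
  have h := differentiableOn_farPiece hVo (hF.mono hVS) hX hAc hTm hpos hbound hdom
  exact (h.differentiableAt (hVo.mem_nhds hz₀V)).differentiableWithinAt

/-- **The own far piece is `O(1/hs')`**: `‖∫_T kernel‖ ≤ 5·72·π/((7/16)·3hs')`. [folklore] -/
theorem ownFarPiece_norm_le {hs hs' L cc κ : ℝ} {F : ℂ → (Fin 3 → ℂ)}
    (hF : DifferentiableOn ℂ F {z : ℂ | |z.im| < hs ∧ |z.re - cc| < L + hs})
    (hM : ∀ z ∈ {z : ℂ | |z.im| < hs ∧ |z.re - cc| < L + hs}, ‖deriv F z‖ ≤ 2)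
    {X : ℝ → EuclideanSpace ℝ (Fin 3)} (hX : Differentiable ℝ X) (hXu : ∀ τ, ‖deriv X τ‖ = 1)
    (hosc : ∀ τ σ, ‖deriv X τ - deriv X σ‖ ≤ 1 / 2)
    (hFX : ∀ r : ℝ, (r : ℂ) ∈ {z : ℂ | |z.im| < hs ∧ |z.re - cc| < L + hs} →
      F r = fun i => ((⟪X r, EuclideanSpace.single i (1:ℝ)⟫_ℝ : ℝ) : ℂ))
    {A : ℝ → ℝ} (hA : ∀ σ, 0 ≤ A σ) (hκ : 0 ≤ κ) (hhs' : 0 < hs') (h9 : 9 * hs' ≤ hs)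
    {z : ℂ} (hz : z ∈ {z : ℂ | |z.im| < hs' ∧ |z.re - cc| < L + hs'}) :
    ‖∫ σ in {σ : ℝ | L + 8 * hs' ≤ |σ - cc|},
      (((∑ i, (F z i - ((X σ i : ℝ) : ℂ)) ^ 2) + ((κ * A σ : ℝ) : ℂ)) ^ ((3:ℂ) / 2))⁻¹ •
        ((fun i => ((deriv X σ i : ℝ) : ℂ)) ⨯₃ (fun i => F z i - ((X σ i : ℝ) : ℂ)))‖ ≤
      5 * 72 * (Real.pi / ((7 / 16) * (3 * hs'))) := by
  have hmaj := ownFar_majorant hF hM hX hXu hosc hFX hA hκ hhs' h9 z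
  have ha0 : (0:ℝ) < 3 * hs' := by positivity
  have hint : Integrable (fun σ : ℝ => 5 * 72 * ((7 / 16) ^ 2 * (σ - z.re) ^ 2 + (3 * hs') ^ 2)⁻¹) :=
    (integrable_lorentzian ha0 (by norm_num : (7 / 16 : ℝ) ≠ 0) z.re).const_mul _
  have hself : ‖z - z‖ < hs' := by simp [hhs']
  have h1 : ‖∫ σ in {σ : ℝ | L + 8 * hs' ≤ |σ - cc|},
      (((∑ i, (F z i - ((X σ i : ℝ) : ℂ)) ^ 2) + ((κ * A σ : ℝ) : ℂ)) ^ ((3:ℂ) / 2))⁻¹ •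
        ((fun i => ((deriv X σ i : ℝ) : ℂ)) ⨯₃ (fun i => F z i - ((X σ i : ℝ) : ℂ)))‖ ≤
      ∫ σ in {σ : ℝ | L + 8 * hs' ≤ |σ - cc|}, 5 * 72 * ((7 / 16) ^ 2 * (σ - z.re) ^ 2 + (3 * hs') ^ 2)⁻¹ := by
    refine norm_integral_le_of_norm_le hint.integrableOn ?_
    filter_upwards [ae_restrict_mem (by
      have : IsClosed {σ : ℝ | L + 8 * hs' ≤ |σ - cc|} :=
        isClosed_le continuous_const (continuous_abs.comp (continuous_id.sub continuous_const))
      exact this.measurableSet)] with σ hσ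
    exact hmaj z hz hself σ hσ
  have h2 : ∫ σ in {σ : ℝ | L + 8 * hs' ≤ |σ - cc|}, 5 * 72 * ((7 / 16) ^ 2 * (σ - z.re) ^ 2 + (3 * hs') ^ 2)⁻¹ ≤
      ∫ σ, 5 * 72 * ((7 / 16) ^ 2 * (σ - z.re) ^ 2 + (3 * hs') ^ 2)⁻¹ :=
    setIntegral_le_integral hint (Filter.Eventually.of_forall fun σ => by positivity)
  refine h1.trans (h2.trans ?_)
  rw [integral_const_mul, integral_lorentzian ha0 (by norm_num : (7 / 16 : ℝ) ≠ 0) z.re, abs_of_pos (by norm_num : (0:ℝ) < 7 / 16)]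

end Summit.NavierStokesRegularity.NavierStokesRegularity.Theorems.StadiumOwnFarPiece

end
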